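import Summits.MatrixMultiplication.OmegaCensus.STPPRankPaperTable
import Summits.MatrixMultiplication.OmegaCensus.STPPKneserFilter
import Summits.MatrixMultiplication.OmegaCensus.STPPRepresentationCount
import Summits.MatrixMultiplication.OmegaCensus.STPPBlockVolumeAlignedLaw
import Summits.MatrixMultiplication.OmegaCensus.STPPClosureFilter
import Summits.MatrixMultiplication.OmegaCensus.STPPAlignedDoubleKneserFilter
import Summits.MatrixMultiplication.OmegaCensus.STPPAlignedInvolutionClash

/-!
# ω-census (abelian STPP census): a KERNEL LISTER for «no STPP family of an abelian group of order `n` beats» — definitions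

HONEST FRAMING (pub-omega census; verbatim): lottery ticket; floor = certified bounds/negative ranges.
Census STRUCTURE (seat pub-omega-stpp-2 gen 29, 2026-08-29), family (b2).  Pure finite bookkeeping; nothing here is progress on `ω`.

The census word «`G` admits no beating STPP family» (no simultaneous-triple-product family `(Aᵢ,Bᵢ,Cᵢ)ᵢ` of `G` with `Σᵢ|Aᵢ||Bᵢ||Cᵢ| > |G|`,
CKSU 2005 Def. 5.1 / Thm. 5.5) has so far a KERNEL part (per-leaf kill theorems, e.g. `ℤ₆₁` 54/54) and an ENGINE part (the completeness of the leaf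
list: lister.c v0.14).  This file defines the kernel replacement of the engine part: a depth-first search over COUNT VECTORS of admissible block
shapes (every multiset of shapes is visited as `s₁^{m₁} s₂^{m₂} …` in a fixed shape order) that certifies

  «every MINIMAL beating pattern alive under the tree's pattern laws contains (up to the six role permutations and an injective block embedding
   with coordinatewise `≤`) one of a given list of DEAD patterns»,

pruning subtrees only by MONOTONE budget inequalities that are tree theorems for every extension of the current partial pattern:
representation count (`STPPRepresentationCount.n9`: `Σab + Σbc ≤ n + b_j`, three rotations), the aligned block-volume law N16 at the first block
(`CubeNB.vol_add_sum_AC_BC_le` and rotations: `vol(i₀) + Σ_{k≠i₀} q_k(p_k+r_k) ≤ n`), the rank law N7 in the tree's `paper` form at the first block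
(`STPPRank.rlbPaper_add_sum_gain_le_card_of_isSTPP`: `rlbPaper(i₀) + Σ_{k≠i₀} maxflat_k ≤ n`) and in pure form (`sum_gain_le_card_of_isSTPP`:
`Σ maxflat_k ≤ n`), the N7/N16 budgets turned into an upper bound for the volume of any extension by 1-D unbounded-knapsack tables over the remaining shapes
(LITERAL packed rows per chunk of 16 shapes, certified by the local inequalities `rowsOK` / `chunksOK`).  Leaves (beating partial patterns) are tested for minimality, then by the
tree's card-vector filters (`CubeNB.N9Dead`, `CubeNB.N16Dead`, N7 (`n7Dead`, this file), `STPPKneser.N8Dead`, `CubeNB.N12Dead`,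
`CubeNB.N18Dead`, `CubeNB.N19Dead`), then for dead-core containment (`containsDead`).  Soundness (`scan … = true` ⇒ no beating family) is the sibling
file `STPPKernelListerSound.lean`; the `decide` rows and the per-group capstones are separate files.  Python twin (node-exact):
HOME `pub-omega-stpp-2-g29/code/klister_lean.py` (checkpoint spacing 16).  Design card: HOME `pub-omega-stpp-2-g29/CAPSTONE-REDESIGN-SPEC.md`.

References: H. Cohn, R. Kleinberg, B. Szegedy, C. Umans, FOCS 2005 (arXiv:math/0511460), Def. 5.1, Thm. 5.5.
-/

namespace Summit.MatrixMultiplication.OmegaCensus.KLister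

open STPPRank

/-! ## Shapes and their costs -/

/-- A block shape `(a, b, c) = (|A|, |B|, |C|)`. [folklore] -/
abbrev Shape := ℕ × ℕ × ℕ

/-- Volume `abc`. [folklore] -/
def svol (s : Shape) : ℕ := s.1 * s.2.1 * s.2.2
/-- `ab`. [folklore] -/
def pab (s : Shape) : ℕ := s.1 * s.2.1
/-- `bc`. [folklore] -/
def pbc (s : Shape) : ℕ := s.2.1 * s.2.2
/-- `ca` (written `a·c`). [folklore] -/
def pca (s : Shape) : ℕ := s.1 * s.2.2
/-- The largest flattening `max(ab, bc, ca)` (the `gain` of the best direction). [folklore] -/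
def maxflat (s : Shape) : ℕ := max (pab s) (max (pbc s) (pca s))
/-- N16 cost in the `A`-reading: `a(b+c)`. [folklore] -/
def qa (s : Shape) : ℕ := s.1 * (s.2.1 + s.2.2)
/-- N16 cost in the `B`-reading: `b(a+c)`. [folklore] -/
def qb (s : Shape) : ℕ := s.2.1 * (s.1 + s.2.2)
/-- N16 cost in the `C`-reading: `(a+b)c`. [folklore] -/
def qc (s : Shape) : ℕ := (s.1 + s.2.1) * s.2.2
/-- The smallest of the three products (minimality margin of a block). [folklore] -/
def minprod (s : Shape) : ℕ := min (pab s) (min (pbc s) (pca s))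
/-- `rlbPaper` of a shape. [folklore] -/
def rlb (s : Shape) : ℕ := rlbPaper s.1 s.2.1 s.2.2

/-- Admissibility of a single block in an abelian group of order `n`: entries `≥ 1`, `ab, bc, ca, abc ≤ n`. [folklore] -/
def adm (n : ℕ) (s : Shape) : Bool := decide (1 ≤ s.1 ∧ 1 ≤ s.2.1 ∧ 1 ≤ s.2.2 ∧ pab s ≤ n ∧ pbc s ≤ n ∧ pca s ≤ n ∧ svol s ≤ n)

/-- All admissible shapes with prescribed volume `v` (lexicographic). [folklore] -/
def shapesOfVol (n v : ℕ) : List Shape :=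
  ((List.range (n + 1)).flatMap fun a => (List.range (n / max a 1 + 1)).flatMap fun b =>
    (List.range (n / max (a * b) 1 + 1)).map fun c => (a, b, c)).filter fun s => adm n s && decide (svol s = v)

/-- The shape list of the lister: FAT shapes (`min ≥ 2`) by decreasing volume, then THIN shapes (`min = 1`) by decreasing volume. [folklore] -/
def shapeList (n : ℕ) : List Shape :=
  ((List.range n).reverse.flatMap fun v => (shapesOfVol n (v + 1)).filter fun s => decide (2 ≤ min s.1 (min s.2.1 s.2.2))) ++
  ((List.range n).reverse.flatMap fun v => (shapesOfVol n (v + 1)).filter fun s => ¬ decide (2 ≤ min s.1 (min s.2.1 s.2.2)))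

/-! ## Packed bound tables (literal, checkpointed) -/

/-- Base of the packed rows: every knapsack entry is `< 512` (twin: max entry 460 at `n = 61`). [folklore] -/
def PB : ℕ := 512

/-- Entry `c` of a packed row `r = Σ_c row[c]·PB^c`. [folklore] -/
def lk (r c : ℕ) : ℕ := r / PB ^ c % PB

/-- The four budget costs of a shape that carry a bound table, in the order `(maxflat, qa, qb, qc)` (the representation-count budgets act through `St.fits` only:
the twin shows their tables never bind). [folklore] -/
def costs (s : Shape) : List ℕ := [maxflat s, qa s, qb s, qc s]

/-- LOCAL KNAPSACK CERTIFICATE of a packed row set `rows` (four rows) for a list of shapes `ss` and width `W`: every row is monotone in the column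
(`lk r c ≤ lk r (c+1)`), and for every shape `s ∈ ss`, every budget `X` and every column `c ≥ cost_X(s)`: `svol s + lk r_X (c − cost_X s) ≤ lk r_X c`.  These two
inequalities are exactly what makes `lk r_X budget` an upper bound for the volume of any multiset of shapes from `ss` of total `X`-cost `≤ budget` (peel one shape,
induct). [folklore] -/
def rowsOK (W : ℕ) (rows : List ℕ) (ss : List Shape) : Bool :=
  Nat.beq rows.length 4 &&
  (rows.all fun r => (List.range (W - 1)).all fun c => Nat.ble (lk r c) (lk r (c + 1))) &&
  (ss.all fun s => (List.zip rows (costs s)).all fun p =>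
    (List.range W).all fun c => Nat.blt c p.2 || Nat.ble (svol s + lk p.1 (c - p.2)) (lk p.1 c))

/-- Certificate of a CHUNKED table: chunk `i` carries rows valid for all shapes of chunks `≥ i` — checked as: rows of chunk `i` dominate rows of chunk `i+1`
columnwise, and satisfy the local certificate for the shapes of chunk `i` itself. [folklore] -/
def chunksOK (W : ℕ) : List (List ℕ × List Shape) → Bool
  | [] => true
  | [(rows, ss)] => rowsOK W rows ss
  | (rows, ss) :: (rows', ss') :: rest =>
    rowsOK W rows ss && ((List.zip rows rows').all fun p => (List.range W).all fun c => Nat.ble (lk p.2 c) (lk p.1 c)) &&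
      chunksOK W ((rows', ss') :: rest)

/-! ## Search state -/

/-- The DFS state: sums over the current partial pattern and the remaining i₀-budgets. [folklore] -/
structure St where
  /-- `Σ abc` -/ vol : ℕ
  /-- `Σ ab` -/ sab : ℕ
  /-- `Σ bc` -/ sbc : ℕ
  /-- `Σ ca` -/ sca : ℕ
  /-- `Σ maxflat` -/ smf : ℕ
  /-- `min a` (or `n+1` when empty) -/ mina : ℕ
  /-- `min b` -/ minb : ℕ
  /-- `min c` -/ minc : ℕ
  /-- `min minprod` (minimality margin) -/ mm : ℕ
  /-- a first block has been placed -/ has0 : Bool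
  /-- remaining N7 budget at `i₀`: `n − rlbPaper(i₀) − Σ_{k≠i₀} maxflat_k` -/ r7 : ℕ
  /-- remaining N16 budgets at `i₀` -/ ra : ℕ
  /-- 〃 -/ rb : ℕ
  /-- 〃 -/ rc : ℕ
  deriving DecidableEq

/-- The empty state. [folklore] -/
def St.init (n : ℕ) : St := ⟨0, 0, 0, 0, 0, n + 1, n + 1, n + 1, n + 1, false, n, n, n, n⟩

/-- Can the shape `s` be added without breaking a monotone budget (`N2`, representation count ×3, N7 pure / at `i₀`, N16 at `i₀` ×3)?  Boolean arithmetic only.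
[folklore] -/
def St.fits (n : ℕ) (st : St) (s : Shape) : Bool :=
  let sab := st.sab + pab s
  let sbc := st.sbc + pbc s
  let sca := st.sca + pca s
  Nat.ble sab n && Nat.ble sbc n && Nat.ble sca n && Nat.ble (st.smf + maxflat s) n &&
    Nat.ble (sab + sbc) (n + min st.minb s.2.1) && Nat.ble (sbc + sca) (n + min st.minc s.2.2) && Nat.ble (sca + sab) (n + min st.mina s.1) &&
    (if st.has0 then Nat.ble (maxflat s) st.r7 && Nat.ble (qa s) st.ra && Nat.ble (qb s) st.rb && Nat.ble (qc s) st.rc else Nat.ble (rlb s) n)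

/-- Add the shape `s` (assumed to fit). [folklore] -/
def St.add (n : ℕ) (st : St) (s : Shape) : St :=
  { vol := st.vol + svol s, sab := st.sab + pab s, sbc := st.sbc + pbc s, sca := st.sca + pca s, smf := st.smf + maxflat s,
    mina := min st.mina s.1, minb := min st.minb s.2.1, minc := min st.minc s.2.2, mm := min st.mm (minprod s), has0 := true,
    r7 := if st.has0 then st.r7 - maxflat s else n - rlb s,
    ra := if st.has0 then st.ra - qa s else n - svol s, rb := if st.has0 then st.rb - qb s else n - svol s,
    rc := if st.has0 then st.rc - qc s else n - svol s }

/-- The remaining budgets of a state that carry a bound table, in the order of `costs` (the i₀-budgets are `n` before the first block). [folklore] -/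
def St.budgets (n : ℕ) (st : St) : List ℕ :=
  [if st.has0 then min st.r7 (n - st.smf) else n - st.smf, if st.has0 then st.ra else n, if st.has0 then st.rb else n, if st.has0 then st.rc else n]

/-- Upper bound for the volume of any extension by the remaining shapes: the least packed-table entry over the four budgets. [folklore] -/
def bound (n : ℕ) (st : St) (rows : List ℕ) : ℕ :=
  ((List.zip rows (st.budgets n)).map fun p => lk p.1 p.2).foldl min (n + 1)

/-! ## Leaves: list-native card-vector filters (mirrors of the tree predicates) -/

/-- `Σ ab`, `Σ bc`, `Σ ca`, `Σ abc`, `Σ qa`, `Σ qb`, `Σ qc` of a pattern. [folklore] -/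
def sums (P : List Shape) : ℕ × ℕ × ℕ × ℕ × ℕ × ℕ × ℕ :=
  ((P.map pab).sum, (P.map pbc).sum, (P.map pca).sum, (P.map svol).sum, (P.map qa).sum, (P.map qb).sum, (P.map qc).sum)

/-- Representation count (tree `CubeNB.N9Dead`, three rotations): some block `t` has `Σab+Σbc > n+b_t`, `Σbc+Σca > n+c_t` or `Σca+Σab > n+a_t`. [folklore] -/
def repDead (n : ℕ) (P : List Shape) : Bool :=
  let S := sums P
  P.any fun t => Nat.blt (n + t.2.1) (S.1 + S.2.1) || Nat.blt (n + t.2.2) (S.2.1 + S.2.2.1) || Nat.blt (n + t.1) (S.2.2.1 + S.1)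

/-- N16 (tree `CubeNB.N16Dead`, three readings): some block `t` has `vol_t + Σ_{k≠t} q_k(p_k+r_k) > n` for `q = a, b, c`. [folklore] -/
def n16DeadL (n : ℕ) (P : List Shape) : Bool :=
  let S := sums P
  P.any fun t => Nat.blt (n + qa t) (svol t + S.2.2.2.2.1) || Nat.blt (n + qb t) (svol t + S.2.2.2.2.2.1) || Nat.blt (n + qc t) (svol t + S.2.2.2.2.2.2)

/-- The positive divisors of `n` as a list. [folklore] -/
def divList (n : ℕ) : List ℕ := (List.range (n + 1)).filter fun d => decide (0 < d ∧ d ∣ n)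

/-- Kneser's lower bound `(⌈s/d⌉ + ⌈t/d⌉ − 1)·d` (tree `STPPKneser.kneserLB`). [folklore] -/
def kLB (s t d : ℕ) : ℕ := ((s + d - 1) / d + (t + d - 1) / d - 1) * d

/-- N8, one reading, on the product lists (tree `STPPKneser.N8Dead1` with `a, b, c` read off `P`): blocks `j ≠ k` with (K1a) or (K1b) at `j` or (K2) at `(j,k)` violated
for every divisor. [folklore] -/
def n8Dead1L (n : ℕ) (D : List ℕ) (P : List Shape) : Bool :=
  let X := (P.map pab).sum
  let Y := (P.map pbc).sum
  let Z := (P.map pca).sum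
  (List.range P.length).any fun j => (List.range P.length).any fun k => !(Nat.beq j k) &&
    (let tj := P.getD j (0, 0, 0)
     let tk := P.getD k (0, 0, 0)
     (D.all fun d => Nat.blt (n - pca tj) (kLB X (Y - pbc tj) d)) || (D.all fun d => Nat.blt (n - pca tj) (kLB (X - pab tj) Y d)) ||
       (D.all fun d => Nat.blt (n - Z) (kLB (pab tj) (pbc tk) d)))

/-- Role image of a pattern by `(a,b,c) ↦ (b,c,a)`. [folklore] -/
def rotP (P : List Shape) : List Shape := P.map fun s => (s.2.1, s.2.2, s.1)
/-- Role image of a pattern by `(a,b,c) ↦ (c,b,a)`. [folklore] -/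
def revP (P : List Shape) : List Shape := P.map fun s => (s.2.2, s.2.1, s.1)

/-- N8 (tree `STPPKneser.N8Dead`): the three rotations. [folklore] -/
def n8DeadL (n : ℕ) (P : List Shape) : Bool :=
  let D := divList n
  n8Dead1L n D P || n8Dead1L n D (rotP P) || n8Dead1L n D (rotP (rotP P))

/-- N18, one reading (tree `CubeNB.N18Dead1`): some block `i` (another block present) with
`n − Σ_{k≠i} a_k c_k < kLB(b_i, vol_i + kLB(a_i, Σ_{k≠i} b_k c_k, d′), d)` for all divisors `d, d′`. [folklore] -/
def n18Dead1L (n : ℕ) (D : List ℕ) (P : List Shape) : Bool :=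
  let Y := (P.map pbc).sum
  let Z := (P.map pca).sum
  Nat.blt 1 P.length && P.any fun t =>
    D.all fun d => D.all fun d' => Nat.blt (n - (Z - pca t)) (kLB t.2.1 (svol t + kLB t.1 (Y - pbc t) d') d)

/-- N18 (tree `CubeNB.N18Dead`): the six role readings. [folklore] -/
def n18DeadL (n : ℕ) (P : List Shape) : Bool :=
  let D := divList n
  n18Dead1L n D P || n18Dead1L n D (rotP P) || n18Dead1L n D (rotP (rotP P)) ||
    n18Dead1L n D (revP P) || n18Dead1L n D (revP (rotP (rotP P))) || n18Dead1L n D (revP (rotP P))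

/-- N12, one rotation: the tree's arithmetic statement `CubeNB.n12Stmt` on the list sums (`ta = max a`, `tc = max c`). [folklore] -/
def n12Dead1L (n : ℕ) (P : List Shape) : Bool :=
  CubeNB.n12Stmt n (P.map pab).sum (P.map pbc).sum (P.map pca).sum (P.map svol).sum ((P.map fun s => s.1).foldl max 0)
    ((P.map fun s => s.2.2).foldl max 0)

/-- N12 (tree `CubeNB.N12Dead`): the three rotations. [folklore] -/
def n12DeadL (n : ℕ) (P : List Shape) : Bool := n12Dead1L n P || n12Dead1L n (rotP P) || n12Dead1L n (rotP (rotP P))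

/-- The leaf filters, cheap first. [folklore] -/
def treeDeadL (n : ℕ) (P : List Shape) : Bool := repDead n P || n16DeadL n P || n8DeadL n P || n18DeadL n P || n12DeadL n P

/-! ## Leaves: dead-core test by canonical form -/

/-- Lexicographic `<` on shapes. [folklore] -/
def ltS (s t : Shape) : Bool := Nat.blt s.1 t.1 || (Nat.beq s.1 t.1 && (Nat.blt s.2.1 t.2.1 || (Nat.beq s.2.1 t.2.1 && Nat.blt s.2.2 t.2.2)))

/-- Lexicographic `<` on patterns (lists of shapes). [folklore] -/
def ltP : List Shape → List Shape → Bool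
  | [], [] => false
  | [], _ :: _ => true
  | _ :: _, [] => false
  | s :: P, t :: Q => ltS s t || (s == t && ltP P Q)

/-- Sorted form of a pattern (insertion sort by `ltS`). [folklore] -/
def sortP (P : List Shape) : List Shape := P.insertionSort fun s t => ltS s t

/-- The six role images of a pattern. [folklore] -/
def roleImagesP (P : List Shape) : List (List Shape) := [P, rotP P, rotP (rotP P), revP P, revP (rotP (rotP P)), revP (rotP P)]

/-- Canonical form: the lexicographically least sorted role image (census `patterns.canon`). [folklore] -/
def canonP (P : List Shape) : List Shape :=
  ((roleImagesP P).map sortP).foldl (fun acc Q => if ltP Q acc then Q else acc) (sortP P)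

/-- Dead-core test for a MINIMAL beating leaf: its canonical form is one of the (canonical) dead patterns. [folklore] -/
def isDead (dead : List (List Shape)) (P : List Shape) : Bool := dead.contains (canonP P)

/-- A beating leaf is fine iff it is NOT minimal (`vol − n > mm`), or dead by a filter, or a dead pattern. [folklore] -/
def leafOK (n : ℕ) (dead : List (List Shape)) (st : St) (P : List Shape) : Bool :=
  Nat.blt (n + st.mm) st.vol || treeDeadL n P || isDead dead P

/-! ## The search -/

/-- Try to add ONE more copy of the shape `s`, then up to `fuel` further copies, continuing with `k` after each count.  A copy that does not fit a budget ends the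
chain (vacuously fine); a copy that would overshoot the minimality margin (`vol + abc > n + min(mm, minprod s)`) can only produce non-minimal beating patterns and
ends the chain; a copy that makes the pattern beating is a LEAF. [folklore] -/
def addOne (n : ℕ) (dead : List (List Shape)) (k : St → List Shape → Bool) (s : Shape) : ℕ → St → List Shape → Bool
  | 0, _, _ => true
  | fuel + 1, st, P =>
    !(st.fits n s) || Nat.blt (n + min st.mm (minprod s)) (st.vol + svol s) ||
      (let st' := st.add n s
       if n < st'.vol then leafOK n dead st' (P ++ [s]) else k st' (P ++ [s]) && addOne n dead k s fuel st' (P ++ [s]))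

/-- The scan of ONE chunk of shapes (all sharing the packed rows `rows` of the chunk's first position) followed by the continuation `kAfter` (the later chunks).
At each shape: prune by the volume bound (valid for every later shape too, since a chunk's rows dominate all later rows), else «no copy» ∧ «≥ 1 copy». [folklore] -/
def scanS (n : ℕ) (dead : List (List Shape)) (rows : List ℕ) (kAfter : St → List Shape → Bool) : List Shape → St → List Shape → Bool
  | [], st, P => kAfter st P
  | s :: ss, st, P =>
    Nat.ble (st.vol + bound n st rows) n || (scanS n dead rows kAfter ss st P && addOne n dead (scanS n dead rows kAfter ss) s n st P)

/-- **The kernel lister** over the chunked shape list. [folklore] -/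
def scanC (n : ℕ) (dead : List (List Shape)) : List (List ℕ × List Shape) → St → List Shape → Bool
  | [], _, _ => true
  | (rows, ss) :: rest, st, P => scanS n dead rows (scanC n dead rest) ss st P

/-- **Root chunks by first block**: for every shape `s` of the chunked list with `sel s`, certify the patterns whose FIRST block (in list order) is `s`
(`addOne` from the empty state, continuing with the scan of everything after `s`). [folklore] -/
def scanFirstS (n : ℕ) (dead : List (List Shape)) (sel : Shape → Bool) (rows : List ℕ) (kAfter : St → List Shape → Bool) : List Shape → Bool
  | [] => true
  | s :: ss => (!(sel s) || addOne n dead (scanS n dead rows kAfter ss) s n (St.init n) []) && scanFirstS n dead sel rows kAfter ss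

/-- 〃 over the chunk list. [folklore] -/
def scanFirstC (n : ℕ) (dead : List (List Shape)) (sel : Shape → Bool) : List (List ℕ × List Shape) → Bool
  | [] => true
  | (rows, ss) :: rest => scanFirstS n dead sel rows (scanC n dead rest) ss && scanFirstC n dead sel rest

end Summit.MatrixMultiplication.OmegaCensus.KLister
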